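import Summits.QuantumFields.YangMills.Theorems.FluctuationComparisonRegPrIntLS1aAlphaAdmissibleSchedule
import Summits.QuantumFields.YangMills.Theorems.FluctuationComparisonRegPrIntLS1aResDensityRegSetUniv
import HarnessLib

/-!
# S1a · UV3-NODE §69.14 — THE (m2) DOOR FOR ANY EVERYWHERE-CONTINUOUS VERSION: §87.3's «common-version» junction — the Γ-averaged canonical version of `ρ_k` EQUALS every
# continuous a.e.-representative of `ρ_k` at EVERY point (px17 g21 ✓p826313: `regSet = univ`), so class membership read on the canonical version (✓p824320 ∕ ✓p825116 ∕ ✓p826090)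
# IS class membership of px20 g22's one version (✓p826598 `runClassMembershipH_pwc`'s `ρ j`, continuous everywhere) at the uncut heights — no inhabitant needed for the junction

Cell `ym3-torus` (YM ladder rung R3 = continuum `SU(2)` Yang–Mills on the three-torus — a RUNG: NOT d = 4, NOT infinite volume, NOT a mass gap, NOT Clay).
Width seat «width 8» `ym3-torus-px8` (gen 24), FREE px helper on crux `stmt-QuantumFields-20520`, count-neutral, DEFINITION-FREE, default heartbeats.

WHY.  UV3-NODE §87.3 (px20 g22): «(m) for the SAME `ρ` as (p)(w)(c) — px17 g20's one-version door reads (m) on the Γ-averaged canonical version; ✓p826598's `ρ j` is continuous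
everywhere, so `canonVersion dU_j (orbAvg (ρ j))` is available with `regSet = univ` — a bookkeeping junction once an (m)-inhabitant exists».  The junction does not need the
inhabitant: `BalabanUVClass.Mem` is a property of a FUNCTION, and two everywhere-continuous a.e.-equal functions on the configuration torus are EQUAL (product Haar charges open sets).
By ✓`…S1aInvariantVersion.canonVersion_orbAvg_eqOn_of_continuousOn` (at `U = univ`) and ✓`…S1aLevelLawInvariance.resDensity_comp_gaugeAct_ae_eq`, the door's object
`canonVersion dU_k (orbAvg ρ_k)` equals ANY continuous `ρ′ =ᵐ ρ_k` everywhere; so every (m2)-door conclusion holds VERBATIM with `ρ′` in place of the canonical version.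

WHAT (0 `def`, 0 `sorry`; nothing of Bałaban's asserted).
§1 ★★ `canonVersion_orbAvg_resDensity_eq_of_continuous` — `γ ≥ 0`, `k ≤ m + K`, `ρ′` continuous, `ρ′ =ᵐ[dU_k] ρ_k` ⇒ `canonVersion dU_k (orbAvg ρ_k) = ρ′` (as functions);
   `exists_continuous_eq_canonVersion_orbAvg_resDensity` — conversely the canonical version IS continuous everywhere (it equals px17's continuous representative).
§2 ★★ `mem_continuousVersion_iff` — for every averaging family, parameter record and constant `c`: `Mem av prm (c·canonVersion dU_k (orbAvg ρ_k)) ↔ Mem av prm (c·ρ′)`.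
§3 ★★★ `exists_admissible_schedule_mem_continuousVersion` — ✓p826090 `exists_admissible_schedule_mem` RE-READ on an arbitrary family of everywhere-continuous versions
   `ρ′ K k =ᵐ ρ_k^{(K)}`: ONE admissible schedule, and at every `(K, k ≤ K)` the five displayed binders (`hwin` now DISCHARGED by ✓p826313 inside) give
   `Mem (blockAvg ℰp) {prm (K−k) with β := β_K} (e^{E_k}·ρ′ K k)`.
WHAT THIS FILE IS NOT: the (w)-side identification «px20's `ρ j` read on run `K` is a.e. `Z_K⁻¹·ρ^{(K)}_{K−j}`» (UV3-NODE §67.3 (w): S, typed in pieces — `unitLaw_succ_eq_map_descLaw`,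
`integral_resDensity_mul`; displayed here as the hypothesis `ρ′ =ᵐ ρ_k`, the constant `Z_K⁻¹` rides in `e^κ`); the (R-β1′) `readAtLevel` reading; the four undischarged binders;
(m) at the CUT heights `j < Ts` (§67.3 (m3): a different object); nothing of Bałaban's asserted or proved; 20520 ∕ `YM3TorusSU2` NOT proved; rung R3 — NOT d = 4, NOT infinite volume,
NOT a mass gap, NOT Clay.  Sorry-free, axioms standard.
-/

set_option autoImplicit false

noncomputable section

namespace Summit.QuantumFields.YangMills.Theorems.FluctuationComparisonRegPrIntLS1aAlphaMemOfContinuousVersion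

open MeasureTheory Set
open Literature.MathematicalPhysics.QuantumFieldTheory.Balaban1983to89
open T3ContinuumYM3Torus T3UnitScaleTilt T3UnitLawDensityEML T3RestrictedUnitDensity T3AlphaInputsAC T3AlphaInputsACSchemas T3AlphaInputsACTrivRows BalabanUVClass
open Literature.MathematicalPhysics.QuantumFieldTheory.Balaban1983to89.Node00 (regSet canonVersion)
open Literature.MathematicalPhysics.QuantumFieldTheory.Balaban1983to89.T3OrbitAverage (orbAvg)
open Summit.QuantumFields.YangMills.Theorems.FluctuationComparisonRegPrIntLS1aInvariantVersion (canonVersion_orbAvg_eqOn_of_continuousOn)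
open Summit.QuantumFields.YangMills.Theorems.FluctuationComparisonRegPrIntLS1aResDensityRegSetUniv (exists_continuous_ae_eq_resDensity plaqSmall_subset_regSet_resDensity)
open Summit.QuantumFields.YangMills.Theorems.FluctuationComparisonRegPrIntLS1aAlphaAdmissibleSchedule (exists_admissible_schedule_mem)

variable (F : T3Family) {γ : ℝ}

/-! ## §1 The canonical version equals every continuous representative, everywhere -/

/-- ★★ **THE Γ-AVERAGED CANONICAL VERSION OF `ρ_k` EQUALS EVERY CONTINUOUS A.E.-REPRESENTATIVE AT EVERY POINT** (`γ ≥ 0`, `k ≤ m + K`). [cite: Balaban1987RG1, (0.13) p.254; Balaban1985Averaging, (12)-(13) p.19] -/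
theorem canonVersion_orbAvg_resDensity_eq_of_continuous (hγ : 0 ≤ γ) {K k : ℕ} (hk : k ≤ F.m + K)
    {ρ' : GaugeField (F.P K) k (Matrix.specialUnitaryGroup (Fin 2) ℂ) → ℝ} (hc : Continuous ρ')
    (hae : ρ' =ᵐ[fieldMeasure (F.P K) k (Matrix.specialUnitaryGroup (Fin 2) ℂ)] resDensity F γ K Set.univ k) :
    canonVersion (fieldMeasure (F.P K) k (Matrix.specialUnitaryGroup (Fin 2) ℂ)) (orbAvg (resDensity F γ K Set.univ k)) = ρ' := by
  have hinv : ∀ g : Site (F.P K) k → Matrix.specialUnitaryGroup (Fin 2) ℂ,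
      (fun V => resDensity F γ K Set.univ k (GaugeField.gaugeAct g V)) =ᵐ[fieldMeasure (F.P K) k (Matrix.specialUnitaryGroup (Fin 2) ℂ)]
        resDensity F γ K Set.univ k :=
    fun g => Summit.QuantumFields.YangMills.Theorems.FluctuationComparisonRegPrIntLS1aLevelLawInvariance.resDensity_comp_gaugeAct_ae_eq F hγ K hk g
  have h := canonVersion_orbAvg_eqOn_of_continuousOn (N := 2) (measurable_resDensity F γ K MeasurableSet.univ k).aestronglyMeasurable hinv isOpen_univ
    hc.continuousOn (by rw [Measure.restrict_univ]; exact hae)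
  funext V
  exact h (mem_univ V)

/-- Conversely the canonical version is continuous EVERYWHERE (it equals px17 g21's continuous representative ✓`exists_continuous_ae_eq_resDensity`). [cite: Balaban1985UV3, p.263 (c)] -/
theorem continuous_canonVersion_orbAvg_resDensity (hγ : 0 ≤ γ) {K k : ℕ} (hk : k ≤ F.m + K) :
    Continuous (canonVersion (fieldMeasure (F.P K) k (Matrix.specialUnitaryGroup (Fin 2) ℂ)) (orbAvg (resDensity F γ K Set.univ k))) := by
  obtain ⟨g, hgc, -, -, hae⟩ := exists_continuous_ae_eq_resDensity F hγ K k hk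
  rw [canonVersion_orbAvg_resDensity_eq_of_continuous F hγ hk hgc hae.symm]
  exact hgc

/-! ## §2 Class membership does not see which continuous version is read -/

/-- ★★ **MEMBERSHIP OF THE CANONICAL VERSION IS MEMBERSHIP OF ANY CONTINUOUS VERSION** (same function). [cite: Balaban1985UV3, (41)-(47) pp.266-267] -/
theorem mem_continuousVersion_iff (hγ : 0 ≤ γ) {K k : ℕ} (hk : k ≤ F.m + K)
    {ρ' : GaugeField (F.P K) k (Matrix.specialUnitaryGroup (Fin 2) ℂ) → ℝ} (hc : Continuous ρ')
    (hae : ρ' =ᵐ[fieldMeasure (F.P K) k (Matrix.specialUnitaryGroup (Fin 2) ℂ)] resDensity F γ K Set.univ k)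
    (av : (i : ℕ) → Averaging (F.P K) i (Matrix.specialUnitaryGroup (Fin 2) ℂ)) (prm : ClassParams) (c : ℝ) :
    Mem (P := F.P K) (k := k) av prm (fun V => c * canonVersion (fieldMeasure (F.P K) k (Matrix.specialUnitaryGroup (Fin 2) ℂ)) (orbAvg (resDensity F γ K Set.univ k)) V) ↔
      Mem (P := F.P K) (k := k) av prm (fun V => c * ρ' V) := by
  rw [canonVersion_orbAvg_resDensity_eq_of_continuous F hγ hk hc hae]

/-! ## §3 The admissible-schedule door, read on any family of continuous versions -/

/-- ★★★ **✓`exists_admissible_schedule_mem` FOR CONTINUOUS VERSIONS** (`hwin` discharged inside by ✓p826313): under the package `AlphaInputsT3ACFullTriv …` and the numerics there is ONE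
admissible height schedule `prm` such that for every run `K`, level `k ≤ K` and every continuous `ρ′ =ᵐ ρ_k^{(K)}`, the FOUR remaining displayed binders at `(K, k)` (`hlowc`, `hupc`,
`hRegClass`, `hlfle`) and the large-field clause `hlarge` (stated for `ρ′` itself) give `Mem (blockAvg ℰp) {prm (K−k) with β := β_K} (e^{E_k}·ρ′)`. [cite: Balaban1985UV3, (41)-(47) pp.266-267, (5) p.256, (7) p.257] -/
theorem exists_admissible_schedule_mem_continuousVersion {D : AlphaDataT3 F γ} (W : LFData D) {b₀ p₀ ε₀ C68 Cχ B₃ r CD R₀ C₅ : ℝ} {M₁ : ℕ}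
    (h : AlphaInputsT3ACFullTriv D W b₀ p₀ ε₀ C68 Cχ B₃ M₁ r CD) (hγ : 0 < γ) (hγ1 : γ ≤ 1) (hγe : Real.sqrt γ ≤ Real.exp (1 - p₀)) (hb : 0 ≤ b₀) (hp : 0 ≤ p₀)
    (hr : 0 ≤ r) (hM1 : 1 ≤ M₁) (hMdvd : M₁ ∣ 2 * F.L ^ F.m) (hCD : 0 ≤ CD) (hR₀ : 0 < R₀) :
    ∃ prm : ℕ → ClassParams, AdmissibleClassParams F γ (b₀ / 2) p₀ prm ∧
      (∀ n, (prm n).δ = θBal F.L γ b₀ p₀ n ∧ (prm n).δreg = R₀ ∧ (prm n).δL = θBal F.L γ b₀ p₀ n ∧ (prm n).β = (F.L : ℝ) ^ n / γ ∧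
        (prm n).cLF = B10.pFun (b₀ / 2) p₀ (Real.sqrt (γ * ((F.L : ℝ)⁻¹) ^ n)) ^ 2 / 4 ∧ (prm n).c5 = C₅ ∧ (prm n).cE = 0) ∧
      ∀ (K k : ℕ) (hk : k ≤ K) (ρ' : GaugeField (F.P K) k (Matrix.specialUnitaryGroup (Fin 2) ℂ) → ℝ),
        Continuous ρ' → ρ' =ᵐ[fieldMeasure (F.P K) k (Matrix.specialUnitaryGroup (Fin 2) ℂ)] resDensity F γ K Set.univ k →
        ContinuousOn (D.low K k) {V | PlaqSmall (θBal F.L γ b₀ p₀ (K - k)) V} →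
        ContinuousOn (D.up K k) {V | PlaqSmall (θBal F.L γ b₀ p₀ (K - k)) V} →
        (∀ V : GaugeField (F.P K) k (Matrix.specialUnitaryGroup (Fin 2) ℂ), PlaqSmall (θBal F.L γ b₀ p₀ (K - k)) V →
          IsBackground (fun i => BlockAveraging.blockAvg (P := F.P K) (j := i) ℰp) {U | PlaqSmall R₀ U} k V (D.Umin K k (D.triv K k) V)) →
        (∀ V : GaugeField (F.P K) k (Matrix.specialUnitaryGroup (Fin 2) ℂ),
          Real.exp (D.Ecst K k) * (Real.exp (-(D.Ecst K k) + D.Rm K k) * (D.up K k V - D.low K k V)) ≤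
            Real.exp (-(prm (K - k)).cLF) * Real.exp (C₅ * Fintype.card (Site (F.P K) k))) →
        (∀ (V : GaugeField (F.P K) k (Matrix.specialUnitaryGroup (Fin 2) ℂ)) (S : Finset (Plaq (F.P K) k)),
          (∀ p ∈ S, θBal F.L γ b₀ p₀ (K - k) ≤ GaugeGroup.dist1 (GaugeField.plaqHol V p)) →
            Real.exp (D.Ecst K k) * ρ' V ≤ Real.exp (-((prm (K - k)).cLF * S.card)) * Real.exp (C₅ * Fintype.card (Site (F.P K) k))) →
        Mem (P := F.P K) (k := k) (fun i => BlockAveraging.blockAvg (P := F.P K) (j := i) ℰp) { prm (K - k) with β := (F.scheme ℰp γ).β K }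
          (fun V => Real.exp (D.Ecst K k) * ρ' V) := by
  obtain ⟨prm, hadm, hfields, hmem⟩ := exists_admissible_schedule_mem (F := F) W h hγ hγ1 hγe hb hp hr hM1 hMdvd hCD hR₀
  refine ⟨prm, hadm, hfields, fun K k hk ρ' hc hae hlowc hupc hRegClass hlfle hlarge => ?_⟩
  have hkm : k ≤ F.m + K := hk.trans (Nat.le_add_left K F.m)
  have heq := canonVersion_orbAvg_resDensity_eq_of_continuous F hγ.le hkm hc hae
  have hwin := plaqSmall_subset_regSet_resDensity F hγ.le hk (θBal F.L γ b₀ p₀ (K - k))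
  have hm := hmem K k hk hwin hlowc hupc hRegClass hlfle (fun V S hS => by rw [heq]; exact hlarge V S hS)
  rw [heq] at hm
  exact hm

end Summit.QuantumFields.YangMills.Theorems.FluctuationComparisonRegPrIntLS1aAlphaMemOfContinuousVersion

end
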